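import Summits.Schanuel.Schanuel.Theorems.RootDecomp1KGeneric18

/-!
# RootDecomp1K — lens 6, generation 14: the LOG-SQUARE CARVING (LogSq.lean v3 efa85398…) — continuation (RootDecomp1KGeneric19): §3b imaginary twin (`twin_poly_facts`, twin instance, twin flagship); §4 the decided cells of item 31077 at n = 2 + the formal split; §4b twin cells + the symmetric split

(lens-6 g14 `LogSq.lean` v3, sha256 efa85398…, 1497 l, farm rc 0 · 0 warn · 0 sorry; port by census-1 gen 12 in five parts
RootDecomp1KGeneric17–21 at the section cuts named in CENSUS-REQUEST 2026-08-30T23:30:45Z; each part imports the previous;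
everything mod the cited fact `NesterenkoWaldschmidt1996_thm_1` where marked, otherwise hypothesis-free; `--supports stmt-Schanuel-31077`.)
-/

set_option linter.unusedSectionVars false

noncomputable section

open Complex Polynomial

namespace Summit.Schanuel.Schanuel.Theorems.RootDecomp1KGeneric

open Summit.Schanuel.Schanuel.Theorems.RootDecomp1KHyper
open Summit.Schanuel.Schanuel.Theorems.RootDecomp1KHyper.HyperCell
open Literature.NumberTheory.Transcendental (NesterenkoWaldschmidt1996_thm_1 weilHeight₁)

variable {K : ℕ}

/-- The Mahler measure of a non-zero integer polynomial (over `ℂ`) is at least `1`. -/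
private theorem one_le_mahlerMeasure_int {R : ℤ[X]} (hR : R ≠ 0) :
    1 ≤ (R.map (Int.castRingHom ℂ)).mahlerMeasure := by
  refine one_le_mahlerMeasure_of_one_le_norm_leadingCoeff ?_
  rw [Polynomial.leadingCoeff_map_of_injective (RingHom.injective_int _), eq_intCast,
    Complex.norm_intCast]
  exact_mod_cast Int.one_le_abs (Polynomial.leadingCoeff_ne_zero.mpr hR)

/-! ### §3b  The imaginary twin: `u = iℓ`, `β_r = i·p/q` (degree 2) -/

/-- For `r = p/q ≠ 0`: `i r` is a non-zero root of an irreducible `f ∈ ℤ[X]` of degree `≤ 2`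
(an irreducible factor of `q²X² + p²`) with `log M(f) ≤ log(p² + q²) ≤ 2 log(|p| + q)`. -/
private theorem twin_poly_facts (r : ℚ) (hr0 : r ≠ 0) :
    ∃ f : ℤ[X], Irreducible f ∧ 0 < f.natDegree ∧ f.natDegree ≤ 2 ∧
      aeval (I * ((r : ℝ) : ℂ)) f = 0 ∧ I * ((r : ℝ) : ℂ) ≠ 0 ∧
      Real.log ((f.map (Int.castRingHom ℂ)).mahlerMeasure) ≤ 2 * Real.log ((|r.num| : ℝ) + r.den) := by
  set β : ℂ := I * ((r : ℝ) : ℂ) with hβdef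
  set Q : ℤ[X] := C ((r.den : ℤ) ^ 2) * X ^ 2 + C (r.num ^ 2) with hQ
  have hq0 : (r.den : ℤ) ≠ 0 := by exact_mod_cast r.den_pos.ne'
  have hQ2 : Q.coeff 2 = (r.den : ℤ) ^ 2 := by
    rw [hQ, coeff_add, coeff_C_mul, coeff_X_pow, coeff_C]; simp
  have hQc0 : Q.coeff 0 = r.num ^ 2 := by
    rw [hQ, coeff_add, coeff_C_mul, coeff_X_pow, coeff_C]; simp
  have hQc1 : Q.coeff 1 = 0 := by
    rw [hQ, coeff_add, coeff_C_mul, coeff_X_pow, coeff_C]; simp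
  have hQ0 : Q ≠ 0 := by
    intro h
    have h2 := hQ2
    rw [h, coeff_zero] at h2
    exact pow_ne_zero 2 hq0 h2.symm
  have hQdeg : Q.natDegree ≤ 2 :=
    natDegree_add_le_of_degree_le (natDegree_C_mul_X_pow_le _ _) (by rw [natDegree_C]; exact Nat.zero_le _)
  have hrr : (r : ℂ) * (r.den : ℂ) = (r.num : ℂ) := by
    have h' : ((r * r.den : ℚ) : ℂ) = ((r.num : ℚ) : ℂ) := by rw [Rat.mul_den_eq_num]
    push_cast at h'
    exact h'
  have hQβ : aeval β Q = 0 := by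
    have e : aeval β Q = ((r.den : ℤ) : ℂ) ^ 2 * β ^ 2 + ((r.num : ℤ) : ℂ) ^ 2 := by
      simp [hQ, map_add, map_mul, map_pow, aeval_X]
    rw [e, hβdef, mul_pow, Complex.I_sq]
    push_cast
    rw [← hrr]; ring
  have hβalg : IsAlgebraic ℚ β := isAlgebraic_of_aeval_int hQ0 hQβ
  obtain ⟨g, hgirr, hgdeg, hgβ⟩ :=
    Literature.NumberTheory.Transcendental.NesterenkoWaldschmidt1996.exists_irreducible_int_aeval_eq_zero hβalg
  have hgQ : g ∣ Q := dvd_of_irreducible_of_common_root hgirr hgdeg hgβ hQβ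
  have hgdeg2 : g.natDegree ≤ 2 := (natDegree_le_of_dvd hgQ hQ0).trans hQdeg
  have hβ0 : β ≠ 0 :=
    mul_ne_zero Complex.I_ne_zero (Complex.ofReal_ne_zero.mpr (by exact_mod_cast hr0))
  -- Mahler measures: `M(g) ≤ M(Q) ≤ p² + q² ≤ (|p| + q)²`
  obtain ⟨h, hQgh⟩ := hgQ
  have hh0 : h ≠ 0 := by rintro rfl; rw [mul_zero] at hQgh; exact hQ0 hQgh
  have hMg : (g.map (Int.castRingHom ℂ)).mahlerMeasure ≤ (Q.map (Int.castRingHom ℂ)).mahlerMeasure := by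
    rw [hQgh, Polynomial.map_mul, mahlerMeasure_mul]
    exact le_mul_of_one_le_right (mahlerMeasure_nonneg _) (one_le_mahlerMeasure_int hh0)
  have hMQ : (Q.map (Int.castRingHom ℂ)).mahlerMeasure ≤ ((|r.num| : ℝ) + r.den) ^ 2 := by
    refine (mahlerMeasure_le_sum_norm_coeff _).trans ?_
    have hlt : (Q.map (Int.castRingHom ℂ)).natDegree < 3 := by
      rw [natDegree_map_eq_of_injective (RingHom.injective_int _)]; omega
    rw [sum_over_range' _ (fun _ => norm_zero) 3 hlt]
    simp only [Finset.sum_range_succ, Finset.sum_range_zero, coeff_map, eq_intCast,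
      Complex.norm_intCast, hQc0, hQc1, hQ2, zero_add]
    push_cast
    rw [abs_zero, add_zero, abs_pow, abs_pow, Nat.abs_cast]
    nlinarith [abs_nonneg (r.num : ℝ), (Nat.cast_nonneg r.den : (0 : ℝ) ≤ r.den)]
  have hMg1 := one_le_mahlerMeasure_int hgirr.ne_zero
  have hpq1 : (1 : ℝ) ≤ (|r.num| : ℝ) + r.den := by
    have : (1 : ℝ) ≤ r.den := by exact_mod_cast r.den_pos
    linarith [abs_nonneg (r.num : ℝ)]
  refine ⟨g, hgirr, hgdeg, hgdeg2, hgβ, hβ0, ?_⟩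
  calc Real.log ((g.map (Int.castRingHom ℂ)).mahlerMeasure)
      ≤ Real.log (((|r.num| : ℝ) + r.den) ^ 2) := Real.log_le_log (by linarith) (hMg.trans hMQ)
    _ = 2 * Real.log ((|r.num| : ℝ) + r.den) := by
        rw [Real.log_pow]; norm_num

/-- **P2 (the imaginary-twin instance): `ℓ` log-square Liouville and `ℓ, e^{iℓ}` dependent ⇒
log-square simultaneous approximations of `(iℓ, e^{iℓ})`** (`β_r = i·p/q`, `d_β = 2`). -/
theorem logSqPairApprox_I_mul_of_dependent {ℓ : ℝ} (hℓ : LogSqLiouville ℓ)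
    (hdep : ¬ AlgebraicIndependent ℚ ![(ℓ : ℂ), cexp (I * ℓ)]) : LogSqPairApprox (I * ℓ) := by
  refine logSqPairApprox_of_dependent_gen hℓ rfl hdep (dβ := 2) (fun r => I * ((r : ℝ) : ℂ)) 2
    (by norm_num) twin_poly_facts ?_
  intro r
  rw [← mul_sub, norm_mul, Complex.norm_I, one_mul, ← Complex.ofReal_sub, Complex.norm_real,
    Real.norm_eq_abs]

/-- **P3, IMAGINARY TWIN (mod NW 1996 Thm 1): for every log-square Liouville real `ℓ`, the numbers
`ℓ` and `e^{iℓ}` are algebraically independent over `ℚ`** — equivalently `iℓ, e^{iℓ}` are; the kernel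
is applied at the purely imaginary point `u = iℓ` with the degree-2 approximants `i·p/q`. -/
theorem algebraicIndependent_exp_I_mul_of_logSqLiouville (hNW : NesterenkoWaldschmidt1996_thm_1)
    {ℓ : ℝ} (hℓ : LogSqLiouville ℓ) : AlgebraicIndependent ℚ ![(ℓ : ℂ), cexp (I * ℓ)] := by
  by_contra hdep
  exact not_logSqPairApprox_of_NW hNW
    (mul_ne_zero Complex.I_ne_zero (Complex.ofReal_ne_zero.mpr hℓ.ne_zero))
    (logSqPairApprox_I_mul_of_dependent hℓ hdep)

/-! ## §4  The decided cells (item 31077 at `n = 2`, real log-square-Liouville coordinate in the span) -/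

/-- **Cell «(ℓ, w), any w», `ℓ` log-square Liouville**: Schanuel's bound (mod NW96; `e^ℓ` load-bearing). -/
theorem logSqCell_any (hNW : NesterenkoWaldschmidt1996_thm_1) {ℓ : ℝ} (hℓ : LogSqLiouville ℓ) (w : ℂ) :
    SB 2 ![(ℓ : ℂ), w] :=
  sb_two_of_algebraicIndependent_exp 0 (by simpa using algebraicIndependent_exp_of_logSqLiouville hNW hℓ)

/-- **Cell `(ℓ, ℓ²)`, `ℓ` log-square Liouville**: ℚ-free, in the scopes of S_L′ (31077) and A₃
(`LinLiouville`), and Schanuel's bound HOLDS (mod NW96).  For `ℓ` NOT hyper-Liouville the tuple is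
moreover in A₄ᵈ's scope (33364) — a decided sub-cell of the round-4 residual. -/
theorem logSqCell_sq (hNW : NesterenkoWaldschmidt1996_thm_1) {ℓ : ℝ} (hℓ : LogSqLiouville ℓ) :
    LinearIndependent ℚ ![(ℓ : ℂ), (ℓ : ℂ) ^ 2] ∧ CoordLiouvilleSpan ![(ℓ : ℂ), (ℓ : ℂ) ^ 2] ∧
      LinLiouville ![(ℓ : ℂ), (ℓ : ℂ) ^ 2] ∧ SB 2 ![(ℓ : ℂ), (ℓ : ℂ) ^ 2] := by
  have hL : Liouville ℓ := hℓ.liouville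
  have hℓ0 : (ℓ : ℂ) ≠ 0 := Complex.ofReal_ne_zero.mpr hL.irrational.ne_zero
  have hz : LinearIndependent ℚ ![(ℓ : ℂ), (ℓ : ℂ) * ℓ] :=
    linearIndependent_pair_of_irrational hℓ0 hL.irrational
  rw [sq]
  exact ⟨hz, ⟨(ℓ : ℂ), Submodule.subset_span ⟨0, by simp⟩, Or.inl (by simpa using hL)⟩,
    linLiouville_of_liouville_ratio hL (ℓ : ℂ), logSqCell_any hNW hℓ _⟩

/-- A₄ᵈ-placement of the cell: for `ℓ` log-square Liouville but NOT hyper-Liouville, `(ℓ, ℓ²)`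
satisfies BOTH hypotheses of `FiniteOrderLiouvilleSchanuel` (33364) — and its conclusion holds (mod NW96). -/
theorem logSqCell_sq_in_finiteOrder_scope (hNW : NesterenkoWaldschmidt1996_thm_1) {ℓ : ℝ}
    (hℓ : LogSqLiouville ℓ) (hnot : ¬ HyperLiouville ℓ) :
    LinLiouville ![(ℓ : ℂ), (ℓ : ℂ) ^ 2] ∧ ¬ HyperLinLiouville ![(ℓ : ℂ), (ℓ : ℂ) ^ 2] ∧
      SB 2 ![(ℓ : ℂ), (ℓ : ℂ) ^ 2] := by
  have h := logSqCell_sq hNW hℓ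
  refine ⟨h.2.2.1, ?_, h.2.2.2⟩
  rw [sq]
  have hz : LinearIndependent ℚ ![(ℓ : ℂ), (ℓ : ℂ) * ℓ] := by have := h.1; rwa [sq] at this
  exact not_hyperLinLiouville_of_ratio_not_hyperLiouville hnot hz

/-- **Span cell (mod NW96).**  Schanuel's bound at EVERY pair `z` whose ℚ-span contains a real
log-square-Liouville number `ℓ`: clear denominators (`Mℓ = a z₀ + b z₁`, `a, b ∈ ℤ`), so `Mℓ` and
`e^{Mℓ} = (e^{z₀})^a (e^{z₁})^b` lie in `ℚ(z, e^z)`, and `Mℓ` is again log-square Liouville. -/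
theorem sb_two_of_logSqLiouville_mem_span (hNW : NesterenkoWaldschmidt1996_thm_1) {z : Fin 2 → ℂ}
    {ℓ : ℝ} (hℓ : LogSqLiouville ℓ) (hmem : (ℓ : ℂ) ∈ Submodule.span ℚ (Set.range z)) : SB 2 z := by
  obtain ⟨cf, hcf⟩ := (Submodule.mem_span_range_iff_exists_fun ℚ).mp hmem
  have hsum : ((cf 0 : ℚ) : ℂ) * z 0 + ((cf 1 : ℚ) : ℂ) * z 1 = (ℓ : ℂ) := by
    simpa [Fin.sum_univ_two, Rat.smul_def] using hcf
  set M : ℕ := (cf 0).den * (cf 1).den with hM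
  have hM1 : 1 ≤ M := Nat.mul_pos (cf 0).den_pos (cf 1).den_pos
  set a : ℤ := (cf 0).num * (cf 1).den with ha
  set b : ℤ := (cf 1).num * (cf 0).den with hb
  have hMa : (M : ℚ) * cf 0 = a := by
    rw [hM, ha]; push_cast
    have h := Rat.mul_den_eq_num (cf 0)
    calc ((cf 0).den : ℚ) * (cf 1).den * cf 0 = (cf 0 * (cf 0).den) * (cf 1).den := by ring
      _ = (cf 0).num * (cf 1).den := by rw [h]
  have hMb : (M : ℚ) * cf 1 = b := by
    rw [hM, hb]; push_cast
    have h := Rat.mul_den_eq_num (cf 1)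
    calc ((cf 0).den : ℚ) * (cf 1).den * cf 1 = (cf 1 * (cf 1).den) * (cf 0).den := by ring
      _ = (cf 1).num * (cf 0).den := by rw [h]
  have ha' : (a : ℂ) = (M : ℂ) * ((cf 0 : ℚ) : ℂ) := by exact_mod_cast hMa.symm
  have hb' : (b : ℂ) = (M : ℂ) * ((cf 1 : ℚ) : ℂ) := by exact_mod_cast hMb.symm
  have e1 : (((M : ℝ) * ℓ : ℝ) : ℂ) = (a : ℂ) * z 0 + (b : ℂ) * z 1 := by
    rw [ha', hb']; push_cast; rw [← hsum]; ring
  have hmem1 : (((M : ℝ) * ℓ : ℝ) : ℂ) ∈ IntermediateField.adjoin ℚ (SFset z ∪ {I}) := by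
    rw [e1]
    exact add_mem (mul_mem (intCast_mem _ a) (mem_adjoin_SFset_I (Or.inl ⟨0, rfl⟩)))
      (mul_mem (intCast_mem _ b) (mem_adjoin_SFset_I (Or.inl ⟨1, rfl⟩)))
  have hmem2 : cexp (((M : ℝ) * ℓ : ℝ) : ℂ) ∈ IntermediateField.adjoin ℚ (SFset z ∪ {I}) := by
    rw [e1, Complex.exp_add, Complex.exp_int_mul, Complex.exp_int_mul]
    exact mul_mem (zpow_mem (mem_adjoin_SFset_I (Or.inr ⟨0, rfl⟩)) a)
      (zpow_mem (mem_adjoin_SFset_I (Or.inr ⟨1, rfl⟩)) b)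
  exact sb_two_of_algebraicIndependent
    (algebraicIndependent_exp_of_logSqLiouville hNW (hℓ.nat_mul hM1)) hmem1 hmem2

/-- **Item 31077 (`CoordLiouvilleSchanuel`) at `n = 2`, sub-scope «the span contains `w` with
`w.im = 0` and `w.re` log-square Liouville»: HOLDS (mod NW96).**  The statement below is item
31077's text with `n := 2` and the span hypothesis so restricted; `SB 2 z` is its conclusion verbatim. -/
theorem coordLiouvilleSchanuel_two_of_logSq (hNW : NesterenkoWaldschmidt1996_thm_1) (z : Fin 2 → ℂ)
    (_hz : LinearIndependent ℚ z)
    (hw : ∃ w ∈ Submodule.span ℚ (Set.range z), w.im = 0 ∧ LogSqLiouville w.re) : SB 2 z := by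
  obtain ⟨w, hw, him, hre⟩ := hw
  have e : ((w.re : ℝ) : ℂ) = w := by
    apply Complex.ext <;> simp [him]
  exact sb_two_of_logSqLiouville_mem_span hNW hre (by rw [e]; exact hw)

/-- «Finite log-square type» — the usable form of the residual hypothesis `¬ LogSqLiouville ρ`:
an effective measure `|ρ − r| ≥ exp(−m₀ (log q)²)` for all `r = p/q` with `q ≥ m₀`. -/
theorem not_logSqLiouville_iff {ρ : ℝ} :
    ¬ LogSqLiouville ρ ↔ ∃ m : ℕ, ∀ r : ℚ, m ≤ r.den → ρ ≠ r →
      Real.exp (-((m : ℝ) * Real.log r.den ^ 2)) ≤ |ρ - r| := by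
  unfold LogSqLiouville; push Not; exact Iff.rfl

/-- **The carving of item 31077 at `n = 2` (formal split, mod NW96): Target₂ ⟸ P4 ∧ Residual₂.**
Item 31077's `n = 2` instance (its text verbatim with `n := 2`) follows from its RESIDUAL sub-scope
«no REAL log-square-Liouville number in the ℚ-span» (hypothesis `hres`, OPEN — its model member is
`(ℓ_b, ℓ_b²)`, §5); the complementary sub-scope is decided by `coordLiouvilleSchanuel_two_of_logSq`.
By `not_logSqLiouville_iff` every real Liouville `w` of the residual carries an effective measure
`|w − p/q| ≥ exp(−m₀ (log q)²)` (`q ≥ m₀`), i.e. sits on the far side of NW96's product-form wall. -/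
theorem coordLiouvilleSchanuel_two_split (hNW : NesterenkoWaldschmidt1996_thm_1)
    (hres : ∀ z : Fin 2 → ℂ, LinearIndependent ℚ z →
      (∃ w ∈ Submodule.span ℚ (Set.range z), Liouville w.re ∨ Liouville w.im) →
      (∀ w ∈ Submodule.span ℚ (Set.range z), w.im = 0 → ¬ LogSqLiouville w.re) → SB 2 z) :
    ∀ z : Fin 2 → ℂ, LinearIndependent ℚ z →
      (∃ w ∈ Submodule.span ℚ (Set.range z), Liouville w.re ∨ Liouville w.im) → SB 2 z := by
  intro z hz hw
  by_cases h : ∃ w ∈ Submodule.span ℚ (Set.range z), w.im = 0 ∧ LogSqLiouville w.re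
  · exact coordLiouvilleSchanuel_two_of_logSq hNW z hz h
  · push Not at h
    exact hres z hz hw h

/-! ### §4b  The twin cells: a PURELY IMAGINARY `iℓ` in the span, `ℓ` log-square Liouville -/

/-- **Twin span cell (mod NW96).**  Schanuel's bound at EVERY pair `z` whose ℚ-span contains `iℓ`
with `ℓ` real log-square Liouville: `iMℓ = a z₀ + b z₁` (`a, b ∈ ℤ`), so `Mℓ = −i·(iMℓ)` and
`e^{iMℓ} = (e^{z₀})^a (e^{z₁})^b` lie in `ℚ(z, e^z, i)`, and `Mℓ, e^{iMℓ}` are independent (§3b). -/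
theorem sb_two_of_I_mul_logSqLiouville_mem_span (hNW : NesterenkoWaldschmidt1996_thm_1)
    {z : Fin 2 → ℂ} {ℓ : ℝ} (hℓ : LogSqLiouville ℓ)
    (hmem : I * (ℓ : ℂ) ∈ Submodule.span ℚ (Set.range z)) : SB 2 z := by
  obtain ⟨cf, hcf⟩ := (Submodule.mem_span_range_iff_exists_fun ℚ).mp hmem
  have hsum : ((cf 0 : ℚ) : ℂ) * z 0 + ((cf 1 : ℚ) : ℂ) * z 1 = I * (ℓ : ℂ) := by
    simpa [Fin.sum_univ_two, Rat.smul_def] using hcf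
  set M : ℕ := (cf 0).den * (cf 1).den with hM
  have hM1 : 1 ≤ M := Nat.mul_pos (cf 0).den_pos (cf 1).den_pos
  set a : ℤ := (cf 0).num * (cf 1).den with ha
  set b : ℤ := (cf 1).num * (cf 0).den with hb
  have hMa : (M : ℚ) * cf 0 = a := by
    rw [hM, ha]; push_cast
    have h := Rat.mul_den_eq_num (cf 0)
    calc ((cf 0).den : ℚ) * (cf 1).den * cf 0 = (cf 0 * (cf 0).den) * (cf 1).den := by ring
      _ = (cf 0).num * (cf 1).den := by rw [h]
  have hMb : (M : ℚ) * cf 1 = b := by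
    rw [hM, hb]; push_cast
    have h := Rat.mul_den_eq_num (cf 1)
    calc ((cf 0).den : ℚ) * (cf 1).den * cf 1 = (cf 1 * (cf 1).den) * (cf 0).den := by ring
      _ = (cf 1).num * (cf 0).den := by rw [h]
  have ha' : (a : ℂ) = (M : ℂ) * ((cf 0 : ℚ) : ℂ) := by exact_mod_cast hMa.symm
  have hb' : (b : ℂ) = (M : ℂ) * ((cf 1 : ℚ) : ℂ) := by exact_mod_cast hMb.symm
  have e1 : I * (((M : ℝ) * ℓ : ℝ) : ℂ) = (a : ℂ) * z 0 + (b : ℂ) * z 1 := by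
    rw [ha', hb']; push_cast
    calc I * ((M : ℂ) * (ℓ : ℂ)) = (M : ℂ) * (I * (ℓ : ℂ)) := by ring
      _ = (M : ℂ) * (((cf 0 : ℚ) : ℂ) * z 0 + ((cf 1 : ℚ) : ℂ) * z 1) := by rw [hsum]
      _ = (M : ℂ) * ((cf 0 : ℚ) : ℂ) * z 0 + (M : ℂ) * ((cf 1 : ℚ) : ℂ) * z 1 := by ring
  have hI : I ∈ IntermediateField.adjoin ℚ (SFset z ∪ {I}) :=
    IntermediateField.subset_adjoin ℚ _ (Set.mem_union_right _ rfl)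
  have hmem0 : I * (((M : ℝ) * ℓ : ℝ) : ℂ) ∈ IntermediateField.adjoin ℚ (SFset z ∪ {I}) := by
    rw [e1]
    exact add_mem (mul_mem (intCast_mem _ a) (mem_adjoin_SFset_I (Or.inl ⟨0, rfl⟩)))
      (mul_mem (intCast_mem _ b) (mem_adjoin_SFset_I (Or.inl ⟨1, rfl⟩)))
  have hmem1 : (((M : ℝ) * ℓ : ℝ) : ℂ) ∈ IntermediateField.adjoin ℚ (SFset z ∪ {I}) := by
    have h := mul_mem (neg_mem hI) hmem0
    have e : -I * (I * (((M : ℝ) * ℓ : ℝ) : ℂ)) = (((M : ℝ) * ℓ : ℝ) : ℂ) := by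
      rw [← mul_assoc, neg_mul, Complex.I_mul_I, neg_neg, one_mul]
    rwa [e] at h
  have hmem2 : cexp (I * (((M : ℝ) * ℓ : ℝ) : ℂ)) ∈ IntermediateField.adjoin ℚ (SFset z ∪ {I}) := by
    rw [e1, Complex.exp_add, Complex.exp_int_mul, Complex.exp_int_mul]
    exact mul_mem (zpow_mem (mem_adjoin_SFset_I (Or.inr ⟨0, rfl⟩)) a)
      (zpow_mem (mem_adjoin_SFset_I (Or.inr ⟨1, rfl⟩)) b)
  exact sb_two_of_algebraicIndependent
    (algebraicIndependent_exp_I_mul_of_logSqLiouville hNW (hℓ.nat_mul hM1)) hmem1 hmem2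

/-- **Twin cell «(iℓ, w), any w»** (mod NW96), e.g. `(i·λ_H, w)`. -/
theorem logSqTwinCell_any (hNW : NesterenkoWaldschmidt1996_thm_1) {ℓ : ℝ} (hℓ : LogSqLiouville ℓ)
    (w : ℂ) : SB 2 ![I * (ℓ : ℂ), w] :=
  sb_two_of_I_mul_logSqLiouville_mem_span hNW (z := ![I * (ℓ : ℂ), w]) hℓ
    (Submodule.subset_span ⟨0, rfl⟩)

/-- **Item 31077 at `n = 2`, the SYMMETRIC sub-scope «the span contains a real OR purely imaginary
number whose non-zero coordinate is log-square Liouville»: HOLDS (mod NW96).** -/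
theorem coordLiouvilleSchanuel_two_of_logSq_axis (hNW : NesterenkoWaldschmidt1996_thm_1)
    (z : Fin 2 → ℂ) (_hz : LinearIndependent ℚ z)
    (hw : ∃ w ∈ Submodule.span ℚ (Set.range z),
      (w.im = 0 ∧ LogSqLiouville w.re) ∨ (w.re = 0 ∧ LogSqLiouville w.im)) : SB 2 z := by
  obtain ⟨w, hw, h⟩ := hw
  rcases h with ⟨him, hre⟩ | ⟨hre, him⟩
  · have e : ((w.re : ℝ) : ℂ) = w := by
      apply Complex.ext <;> simp [him]
    exact sb_two_of_logSqLiouville_mem_span hNW hre (by rw [e]; exact hw)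
  · have e : I * ((w.im : ℝ) : ℂ) = w := by
      apply Complex.ext <;> simp [hre]
    exact sb_two_of_I_mul_logSqLiouville_mem_span hNW him (by rw [e]; exact hw)

/-- **The symmetric carving of item 31077 at `n = 2` (formal split, mod NW96):
Target₂ ⟸ (axis cell) ∧ Residual₂′**, the residual now being «no real and no purely imaginary
log-square-Liouville axis number in the ℚ-span» (still containing `(ℓ_b, ℓ_b²)`, §5). -/
theorem coordLiouvilleSchanuel_two_split_axis (hNW : NesterenkoWaldschmidt1996_thm_1)
    (hres : ∀ z : Fin 2 → ℂ, LinearIndependent ℚ z →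
      (∃ w ∈ Submodule.span ℚ (Set.range z), Liouville w.re ∨ Liouville w.im) →
      (∀ w ∈ Submodule.span ℚ (Set.range z),
        (w.im = 0 → ¬ LogSqLiouville w.re) ∧ (w.re = 0 → ¬ LogSqLiouville w.im)) → SB 2 z) :
    ∀ z : Fin 2 → ℂ, LinearIndependent ℚ z →
      (∃ w ∈ Submodule.span ℚ (Set.range z), Liouville w.re ∨ Liouville w.im) → SB 2 z := by
  intro z hz hw
  by_cases h : ∃ w ∈ Submodule.span ℚ (Set.range z),
      (w.im = 0 ∧ LogSqLiouville w.re) ∨ (w.re = 0 ∧ LogSqLiouville w.im)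
  · exact coordLiouvilleSchanuel_two_of_logSq_axis hNW z hz h
  · push Not at h
    exact hres z hz hw (fun w hw' => ⟨fun him => (h w hw').1 him, fun hre => (h w hw').2 hre⟩)

end Summit.Schanuel.Schanuel.Theorems.RootDecomp1KGeneric
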